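import Literature.AlgebraicGeometry.Resolution.RegularHomRegularLocus
import Literature.AlgebraicGeometry.Resolution.ReducedOfSmoothOverReduced
import Literature.AlgebraicGeometry.Resolution.RegularLocalRingsProofs
import Literature.AlgebraicGeometry.Resolution.ExcellentRingsEssFiniteType
import Literature.AlgebraicGeometry.Resolution.ExcellentRingsFieldProofs
import Mathlib.RingTheory.LocalProperties.Reduced
import Mathlib.RingTheory.AdicCompletion.Noetherian
import HarnessLib

/-!
# Reducedness ascends along regular homomorphisms; completions of reduced local G-rings are reduced

Topic: `Literature/AlgebraicGeometry/Resolution`. Pure commutative algebra serving the descent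
step of Cossart–Piltant 2019 (proof of journal Prop. 4.8 = arXiv v1 Prop. 4.6, p. 53):

> "Since `A` is local quasi-excellent, its formal completion `Â` w.r.t. `m_A` is reduced
> [EGA IV (7.8.3)(vii)] and remark (7.8.4)(i), so `K̂ := Tot(Â) = ∏ᵢ K̂ᵢ`, `K̂ᵢ = QF(Â/P̂ᵢ)`
> and the `P̂ᵢ`'s are minimal primes."

i.e. a quasi-excellent (more generally: G-) local ring which is reduced is *analytically
unramified*. The Stacks Project proves this (inside the proof of Tag 07QV, "quasi-excellent rings
are Nagata": "As `R → R^∧` is regular we see that `R^∧` is reduced by Lemma 07QK. In other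
words, `R` is analytically unramified") from Tag 07QK: *reducedness ascends along regular ring
maps of Noetherian rings*, which there is deduced from Serre's criterion `(R₀) + (S₁)`. Here
07QK is proved DIRECTLY, without Serre's criterion and without a Noetherian hypothesis on the
target: a reduced Noetherian ring `A` embeds into `∏ κ(𝔭)` over its minimal primes, a flat `B`
then embeds into `∏ κ(𝔭) ⊗_A B` (`isReduced_of_flat_of_isReduced_tensor`,
`ReducedOfSmoothOverReduced.lean`), and the fibre rings `κ(𝔭) ⊗_A B` of a regular homomorphism
are regular rings, hence reduced (regular local rings are domains, Matsumura Thm. 14.3,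
`isDomain_of_isRegularLocalRing`).

Everything here is PROVED; no definitions, no named facts:

* `IsRegularRing.isReduced'` — a regular ring is reduced;
* `IsRegularHom.isReduced_fiber`, `IsRegularHom.isReduced` — Stacks 07QK (target not assumed
  Noetherian);
* `IsGRing.isReduced_adicCompletion` — the completion of a reduced Noetherian local G-ring is
  reduced; `IsQuasiExcellentRing.isReduced_adicCompletion_iff` — for a quasi-excellent local ring,
  `Â` is reduced iff `A` is (the easy direction by faithful flatness, Stacks 07NZ (1));
* `isReduced_adicCompletion_of_essFiniteType`, `isReduced_adicCompletion_localization_atPrime` —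
  the cases of local rings essentially of finite type over a field, in particular the local rings
  `B_𝔭` of algebras of finite type over a field (which are excellent, `Stacks07QW_field_holds`,
  `IsExcellentRing.of_essFiniteType`), the case of Cossart–Piltant's `A = 𝒪_{X,x}`.

## Sources

* V. Cossart, O. Piltant, J. Algebra 529 (2019) 268–535 = arXiv:1412.0868, proof of Prop. 4.8
  (arXiv v1: Prop. 4.6, p. 53). [CossartPiltant2019]
* The Stacks Project, Tags 07QK (reduced goes up along regular maps), 0C21, 07NZ, 07QV.
  [StacksProject]
* H. Matsumura, *Commutative Ring Theory* (1986), Thm. 14.3, §32 p. 256. [Matsumura1987]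
-/

noncomputable section

open IsLocalRing TensorProduct

namespace Literature.AlgebraicGeometry.Resolution

universe u

/-! ## Regular rings are reduced -/

/-- **A regular ring is reduced**: its localisations at maximal ideals are regular local rings,
hence domains (Matsumura Thm. 14.3, `isDomain_of_isRegularLocalRing`), and reducedness is a local
property. [cite: Matsumura1987, Thm. 14.3] -/
theorem IsRegularRing.isReduced' (R : Type u) [CommRing R] [IsRegularRing R] : IsReduced R := by
  refine isReduced_ofLocalizationMaximal R fun J hJ => ?_
  haveI : IsRegularLocalRing (Localization.AtPrime J) := inferInstance
  haveI : IsDomain (Localization.AtPrime J) := isDomain_of_isRegularLocalRing _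
  infer_instance

/-! ## Stacks 07QK: reducedness ascends along regular homomorphisms -/

section RegularHom

variable {A B : Type u} [CommRing A] [CommRing B] [Algebra A B]

/-- The fibre ring `κ(𝔭) ⊗_A B` of a regular homomorphism over any prime `𝔭` is a regular ring
(geometric regularity tested with the trivial extension `k' = κ(𝔭)`).
[cite: Matsumura1987, §32 p. 256] -/
theorem IsRegularHom.isRegularRing_fiber (h : IsRegularHom A B) (p : Ideal A) [p.IsPrime] :
    IsRegularRing (p.ResidueField ⊗[A] B) := by
  haveI : IsRegularRing (p.ResidueField ⊗[p.ResidueField] (p.ResidueField ⊗[A] B)) :=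
    h.2 p p.ResidueField inferInstance
  exact IsRegularRing.of_ringEquiv
    (R := p.ResidueField ⊗[p.ResidueField] (p.ResidueField ⊗[A] B))
    (Algebra.TensorProduct.lid p.ResidueField (p.ResidueField ⊗[A] B)).toRingEquiv

/-- The fibre rings of a regular homomorphism are reduced. [cite: StacksProject, Tag 07QK] -/
theorem IsRegularHom.isReduced_fiber (h : IsRegularHom A B) (p : Ideal A) [p.IsPrime] :
    IsReduced (p.ResidueField ⊗[A] B) :=
  haveI := h.isRegularRing_fiber p
  IsRegularRing.isReduced' _

/-- **Stacks 07QK — reducedness ascends along regular homomorphisms**: if `A` is Noetherian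
and reduced and `A → B` is regular (flat with geometrically regular fibres), then `B` is reduced.
(The Stacks Project assumes `B` Noetherian and argues with `(R₀) + (S₁)`; here: `B` embeds into
`∏_𝔭 κ(𝔭) ⊗_A B` over the minimal primes of `A` by flatness, and these fibre rings are regular,
hence reduced.) [cite: StacksProject, Tag 07QK] -/
theorem IsRegularHom.isReduced [IsNoetherianRing A] [IsReduced A] (h : IsRegularHom A B) :
    IsReduced B := by
  haveI : Module.Flat A B := h.1
  refine isReduced_of_flat_of_isReduced_tensor A B fun p => ?_
  haveI : p.1.IsPrime := p.2.1.1
  haveI := h.isReduced_fiber p.1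
  -- `B ⊗_A Frac(A/𝔭) ≅ κ(𝔭) ⊗_A B`
  let e₀ : FractionRing (A ⧸ p.1) ≃ₐ[A] p.1.ResidueField :=
    (IsLocalization.algEquiv (nonZeroDivisors (A ⧸ p.1)) (FractionRing (A ⧸ p.1))
      p.1.ResidueField).restrictScalars A
  let e : B ⊗[A] FractionRing (A ⧸ p.1) ≃ₐ[A] p.1.ResidueField ⊗[A] B :=
    (Algebra.TensorProduct.congr (AlgEquiv.refl : B ≃ₐ[A] B) e₀).trans
      (Algebra.TensorProduct.comm A B p.1.ResidueField)
  exact isReduced_of_injective e.toRingHom e.injective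

end RegularHom

/-! ## Completions of reduced local G-rings -/

section Completion

variable {A : Type u} [CommRing A] [IsLocalRing A]

/-- **The completion of a reduced Noetherian local G-ring is reduced** ("`A` is analytically
unramified"; EGA IV₂ 7.8.3 (vii) as quoted by Cossart–Piltant, proof of Prop. 4.8; Stacks, proof
of 07QV): `A → Â` is a regular homomorphism (`IsGRing.isRegularHom_adicCompletion`), so Stacks
07QK applies. [cite: StacksProject, Tag 07QK]
[cite: CossartPiltant2019, proof of Prop. 4.8 (arXiv v1: Prop. 4.6, p. 53)] -/
theorem IsGRing.isReduced_adicCompletion [IsReduced A] (hA : IsGRing A) :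
    IsReduced (AdicCompletion (maximalIdeal A) A) :=
  haveI : IsNoetherianRing A := hA.1
  hA.isRegularHom_adicCompletion.isReduced

/-- If the completion of a Noetherian local ring is reduced, so is the ring (`A → Â` is
injective by Krull's intersection theorem). [cite: StacksProject, Tag 07NZ] -/
theorem isReduced_of_isReduced_adicCompletion [IsNoetherianRing A]
    (h : IsReduced (AdicCompletion (maximalIdeal A) A)) : IsReduced A :=
  isReduced_of_injective (algebraMap A (AdicCompletion (maximalIdeal A) A))
    (AdicCompletion.of_injective (maximalIdeal A) A)

/-- **For a quasi-excellent local ring, `Â` is reduced iff `A` is** (Cossart–Piltant 2019, proof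
of Prop. 4.8: "Since `A` is local quasi-excellent, its formal completion `Â` w.r.t. `m_A` is
reduced [EGA IV (7.8.3)(vii)]"). [cite: CossartPiltant2019, proof of Prop. 4.8 (arXiv v1: Prop. 4.6, p. 53)]
[cite: StacksProject, Tag 07QK] -/
theorem IsQuasiExcellentRing.isReduced_adicCompletion_iff (hA : IsQuasiExcellentRing A) :
    IsReduced (AdicCompletion (maximalIdeal A) A) ↔ IsReduced A :=
  haveI : IsNoetherianRing A := hA.isNoetherianRing
  ⟨fun h => isReduced_of_isReduced_adicCompletion h, fun _ => hA.isGRing.isReduced_adicCompletion⟩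

/-- The completion of a reduced excellent local ring is reduced. [cite: StacksProject, Tag 07QK] -/
theorem IsExcellentRing.isReduced_adicCompletion [IsReduced A] (hA : IsExcellentRing A) :
    IsReduced (AdicCompletion (maximalIdeal A) A) :=
  hA.isQuasiExcellentRing.isGRing.isReduced_adicCompletion

/-- **Local rings essentially of finite type over a field are analytically unramified when
reduced**: such rings are excellent (`Stacks07QW_field_holds`, `IsExcellentRing.of_essFiniteType`).
[cite: StacksProject, Tag 07QK] [cite: StacksProject, Tag 07QW] -/
theorem isReduced_adicCompletion_of_essFiniteType (k : Type u) [Field k] [Algebra k A]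
    [IsReduced A] (h : Algebra.EssFiniteType k A) :
    IsReduced (AdicCompletion (maximalIdeal A) A) :=
  have hk : IsExcellentRing k := Stacks07QW_field_holds k k inferInstance
  (hk.of_essFiniteType h).isReduced_adicCompletion

end Completion

/-- **The case of Cossart–Piltant's `A = 𝒪_{X,x}`**: for an algebra `B` of finite type over a
field `k` and a prime `𝔭` of `B` with `B_𝔭` reduced (e.g. `B` reduced, or a domain), the
completion of the local ring `B_𝔭` is reduced. [cite: CossartPiltant2019, proof of Prop. 4.8 (arXiv v1: Prop. 4.6, p. 53)]
[cite: StacksProject, Tag 07QK] -/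
theorem isReduced_adicCompletion_localization_atPrime (k : Type u) [Field k] {B : Type u}
    [CommRing B] [Algebra k B] [Algebra.FiniteType k B] (p : Ideal B) [p.IsPrime]
    [IsReduced (Localization.AtPrime p)] :
    IsReduced (AdicCompletion (maximalIdeal (Localization.AtPrime p)) (Localization.AtPrime p)) :=
  have hB : IsExcellentRing B := Stacks07QW_field_holds k B inferInstance
  (hB.of_isLocalization (B := Localization.AtPrime p) p.primeCompl).isReduced_adicCompletion

/-- The same for a domain `B` of finite type over a field: every local ring `B_𝔭` is
analytically unramified. [cite: StacksProject, Tag 07QK] -/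
theorem isReduced_adicCompletion_localization_atPrime_of_isDomain (k : Type u) [Field k]
    {B : Type u} [CommRing B] [IsDomain B] [Algebra k B] [Algebra.FiniteType k B]
    (p : Ideal B) [p.IsPrime] :
    IsReduced (AdicCompletion (maximalIdeal (Localization.AtPrime p)) (Localization.AtPrime p)) :=
  isReduced_adicCompletion_localization_atPrime k p

end Literature.AlgebraicGeometry.Resolution
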